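import Mathlib
import Literature.Geometry.Riemannian.GaussianShrinker
import HarnessLib
import Literature.Geometry.Riemannian.CompactShrinkerGapNeedsCompactness

/-!
# WithoutCompactHomotopy — MOVED (deprecated alias module)

Topic `Literature/Uncategorized`. The refuted weakening `WithoutCompactHomotopy` of the crux
`EntropyRung.CompactShrinkerGap` (summit `SmoothPoincare4`) and its refutation
`WithoutCompactHomotopy_false` (Gaussian shrinker on `ℝ⁴`, Cao–Hamilton–Ilmanen 2004 §4), parked
here by the gate (accept-time relocation out of
`Summits/SmoothPoincare4/SmoothPoincare4/Theorems/CompactShrinkerGap/Negative/`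
`WithoutCompactHomotopyFalse.lean`,
2026-08-15), now live — both declarations byte-identical — in
`Literature/Geometry/Riemannian/CompactShrinkerGapNeedsCompactness.lean` (namespace
`Literature.Geometry.Riemannian`; librarian move p95339, 2026-08-16). This module keeps only
deprecated aliases under the old names, so that its one importer (the `Summits` file above, which
states `¬ Literature.Uncategorized.WithoutCompactHomotopy`) keeps compiling (re-checked: deprecation
warning only). Provers: import the `Geometry/Riemannian` module and use the new names; this module
can then be deleted.
-/

namespace Literature.Uncategorized

/-- DEPRECATED alias (librarian move 2026-08-16): this constant is, by definition, the moved
`Literature.Geometry.Riemannian.WithoutCompactHomotopy`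
(statement byte-identical there); kept as a reducible `abbrev` so that files naming the old
constant keep elaborating. [folklore] -/
@[deprecated Literature.Geometry.Riemannian.WithoutCompactHomotopy (since := "2026-08-16")]
abbrev WithoutCompactHomotopy : Prop :=
  Literature.Geometry.Riemannian.WithoutCompactHomotopy

@[deprecated Literature.Geometry.Riemannian.WithoutCompactHomotopy_false (since := "2026-08-16")]
alias WithoutCompactHomotopy_false := Literature.Geometry.Riemannian.WithoutCompactHomotopy_false

end Literature.Uncategorized
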